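import Summits.QuantumFields.YangMills.Theorems.F4SubCurvatureDoorMirrorAnalyticity
import Mathlib
import HarnessLib

/-!
# Route `F4SubCurvatureDoor`, crux ⟨stmt-QuantumFields-23125⟩ `RationalToGeneral`: LINE g17-A «SEXTIC CHANNEL» (planner `ym-idea-3`
# g17, skeleton `l17/sextic_channel.lean` v3 @c3b76051868de215) — registered stub A `stub_mirrorAnalyticity` BY NAME AND SIGNATURE

The name-keyed statements of the skeleton (`InClass`, `MirrorAnalyticity`) copied VERBATIM into this file's own namespace (pattern of
`SqueezedSkewnessEscalatorOfLogConvex`), and the registered stub `theorem stub_mirrorAnalyticity : MirrorAnalyticity` proved by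
projection from the spelled-out tree theorem `F4SubCurvatureDoorGlobalReduction.mirrorAnalyticity` (part 2/2; the sub-curvature
budget conjunct of `InClass` is not used).

Mathlib + tree only; no `sorry`; standard axioms.  HONEST FRAMING: support stub A of an OPEN line; the wall C3 (`AnalyticFiniteType` ∧
`FiniteTypeRigidity`), crux 23125 / 23035, rung R2d (`BalabanLadder.ROT`) and the summit are untouched; the Yang–Mills mass gap is NOT
proved.  Width seat `ym-line-sfw-p2-w4` g20 (cell ym-idea-1, free hands). [cite: GlimmJaffeQP1987, §6.1 Thm. 6.1.3]
-/

set_option autoImplicit false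

noncomputable section

namespace Summit.QuantumFields.YangMills.Theorems.F4SubCurvatureDoorMirrorAnalyticityRegistered

open scoped Topology BigOperators
open Filter Set
open Literature.MathematicalPhysics.QuantumLattice (timeReflection siteToE)
open Summit.QuantumFields.YangMills.Cruxes.OSLegsAtWeakCouplingC.Sketch (IsSignedPerm)

/-- Euclidean `ℝ⁴` (verbatim from the skeleton). -/
abbrev E4 := EuclideanSpace ℝ (Fin 4)

/-- The hypotheses of C3 `GlobalShortRootRigidity`, bundled — verbatim the binders of the tree certificate
`rationalToGeneral_of_global`: continuous off `0`, bounded outside the unit ball, `W(B₄)`-invariant, reflection positive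
across `x₀ = 0`, sub-curvature budget `‖x‖⁸K → 0`, invariant under the isometries preserving `D₄` (verbatim from the skeleton). -/
abbrev InClass (K : E4 → ℝ) : Prop :=
  ContinuousOn K {x | x ≠ 0} ∧
  (∃ C : ℝ, ∀ x, 1 ≤ ‖x‖ → |K x| ≤ C) ∧
  (∀ R : E4 ≃ₗᵢ[ℝ] E4, IsSignedPerm R → ∀ x, K (R x) = K x) ∧
  (∀ (m : ℕ) (x : Fin m → E4) (c : Fin m → ℝ), (∀ i, 0 < x i 0) →
      0 ≤ ∑ i, ∑ j, c i * c j * K (timeReflection 4 (x i) - x j)) ∧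
  Tendsto (fun x : E4 => ‖x‖ ^ 8 * K x) (𝓝[≠] 0) (𝓝 0) ∧
  (∀ R : E4 ≃ₗᵢ[ℝ] E4,
      (∀ z : Fin 4 → ℤ, Even (∑ i, z i) → ∃ w : Fin 4 → ℤ, Even (∑ i, w i) ∧ R (siteToE z) = siteToE w) →
      ∀ x, K (R x) = K x)

/-- Stub A «MIRROR ANALYTICITY» (verbatim from the skeleton): every kernel of the C3 class is jointly real-analytic at every
`x ≠ 0`. -/
abbrev MirrorAnalyticity : Prop :=
  ∀ K : E4 → ℝ, InClass K → ∀ x : E4, x ≠ 0 → AnalyticAt ℝ K x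

/-- **Registered stub A of LINE g17-A, BY NAME AND SIGNATURE**: `MirrorAnalyticity` holds — projection from the spelled-out theorem
`F4SubCurvatureDoorGlobalReduction.mirrorAnalyticity` (sorting signed permutation into the `B₄` chamber, the oblique short-root frame
`(e₀, H₄e₀, θ₃H₄e₀, θ₂H₄e₀)`, OS continuation along each frame vector, Siciak's cross theorem, the analytic chart lemma).
[cite: GlimmJaffeQP1987, §6.1 Thm. 6.1.3] [cite: JarnickiPflug2011, Ch. 5] -/
theorem stub_mirrorAnalyticity : MirrorAnalyticity :=
  fun K hK x hx =>
    Summit.QuantumFields.YangMills.Theorems.F4SubCurvatureDoorGlobalReduction.mirrorAnalyticity K hK.1 hK.2.1 hK.2.2.1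
      hK.2.2.2.1 hK.2.2.2.2.2 x hx

end Summit.QuantumFields.YangMills.Theorems.F4SubCurvatureDoorMirrorAnalyticityRegistered

end
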